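import Literature.MathematicalPhysics.QuantumFieldTheory.LatticeGaugeShenZhuZhuProofs
import Literature.Probability.LatticeModels.DobrushinMetricStates
import Literature.Probability.LatticeModels.ONModelProofs
import HarnessLib

/-!
# Dobrushin's uniqueness regime for lattice gauge theories, and the Shen–Zhu–Zhu reduction

Third file of the Vasserstein (Kantorovich–Rubinstein) form of Dobrushin's contraction technique
(`Literature/Probability/LatticeModels/DobrushinComparisonMetric.lean`,
`…/DobrushinMetricStates.lean`), instantiated for the lattice Yang–Mills (Wilson) specification
`ymSpecification ρ β` on `ℤ^d` of `LatticeGaugeDLR.lean`, and applied to the named fact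
`Literature.MathematicalPhysics.QuantumFieldTheory.shen_zhu_zhu` (Shen–Zhu–Zhu, CMP 400 (2023),
Thm. 1.2 and Cor. 1.6 "Mass gap").

Shen–Zhu–Zhu remark (after Rem. 1.3): "uniqueness for small `β` could possibly also be proven
using the method of Dobrushin [Dobrushin1970]. To this end one would also need to consider the
related Wasserstein metric with respect to the Riemannian distance … such an argument has not
been carried out in detail for lattice Yang Mills in the literature." This file carries out the
*lattice* part of that argument in full generality and isolates the single analytic input:

* `linkPlaqNbr e` — the `6(d-1)` links sharing a plaquette with `e` (the range of the one-link
  conditional law); base points of plaquette-neighbours are at `ℓ^∞`-distance `≤ 1`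
  (`norm_sub_le_one_of_mem_linkPlaqNbr`).
* `siteLaw_ymSpecification_eq_tilted_haar` — the one-link conditional law of `U_e` given the
  other links is the single-link Gibbs measure `Z⁻¹ exp(-β S_{e}(ω^{e←g})) dg` (Haar `dg`), the
  object on which the remaining one-link estimate has to be proved.
* `siteLaw_ymSpecification_congr` — **finite range**: the conditional law of the link variable
  `U_e` under `γ_{e}(· | η)` (density `∝ exp(-β S_{e})` w.r.t. Haar, `S_{e}` the plaquettes
  through `e`) depends on `η` only through `η|_{linkPlaqNbr e}`; hence
  `isKRContraction_ymSpecification`: Dobrushin's condition in the Vasserstein form for the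
  Wilson specification reduces to the one-link Kantorovich–Rubinstein contraction estimate.
* For `G = SU(N)`: the entry map `suEntries : SU(N) → (Fin N → Fin N → ℂ)` induces the σ-algebra
  (`measurableSpace_specialUnitaryGroup_eq_comap`), so local observables Lipschitz in the matrix
  entries determine DLR states; Lipschitz cylinder functions (`IsLipschitzCylinder`, the
  observables of `shen_zhu_zhu`) are bounded measurable local observables with coordinatewise
  Lipschitz constant `K` (`IsLipschitzCylinder.isLipBound`).
* `shen_zhu_zhu_of_dobrushinCondition` — **the reduction**: if for `2 ≤ d`, `2 ≤ N` and every
  't Hooft coupling `|β| < 1/(16(d-1))` the one-link conditional laws of the `SU(N)` Wilson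
  specification at bare coupling `N β` satisfy Dobrushin's condition in the Vasserstein form —
  for SOME bounded weight `r` on `SU(N)` dominating the entry metric (e.g. the bi-invariant
  Riemannian distance) and influence coefficients with row sums `≤ c < 1` over `linkPlaqNbr` — then
  `shen_zhu_zhu d N` holds: DLR uniqueness by `subsingleton_gibbsMeasures_of_isKRContraction`
  and existence (`shen_zhu_zhu_nonempty`), and the mass gap in the printed form
  `|cov(F₁, F₂)| ≤ c₁ e^{-c d(Λ₁, Λ₂)} (K₁ K₂ + ‖F₁‖₂ ‖F₂‖₂)` with `c = -log max(c, 1/2)` and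
  `c₁ = 2 R² A² n² e^{c}`, by `abs_covariance_le_of_isKRContraction` with the profile
  `ℓ(y) = ⌊dist_∞(y, Λ₂)⌋`.
* `shen_zhu_zhu_of_uniformLinkContraction` — the same with one uniform rate `κ` and the
  printed-size Dobrushin constant `6(d-1) κ` (`card_linkPlaqNbr_le`: a link has at most `6(d-1)`
  plaquette neighbours, `card_plaquettesTouching_singleton_le`: at most `2(d-1)` plaquettes).
* Sanity check of the pipeline (non-vacuity): at `β = 0` the one-link laws are Haar, Dobrushin's
  condition holds with zero coefficients, and the machinery yields
  `hasUniqueGibbsMeasure_ymSpecification_fundamentalRep_zero` (`|𝒢| = 1` at infinite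
  temperature for `SU(N)`, every `d`, `N`).

What remains of `shen_zhu_zhu` after this file is exactly the one-link estimate (the hypothesis
`hDob` of `shen_zhu_zhu_of_dobrushinCondition`): for the single-link conditional measure
`ν_h(dQ) ∝ exp(N β Re tr(Q h)) σ_N(dQ)` on `SU(N)` (`h` the sum of the `2(d-1)` staples at the
link), a Kantorovich–Rubinstein bound `W₁^{r}(ν_h, ν_{h'}) ≤ C · r(ω_y, η_y)` when one staple link
`y` is changed, with Dobrushin constant `∑_{y ∈ linkPlaqNbr x} C x y ≤ c < 1`, for some bounded
weight `r` dominating the entry metric. Expected instantiation (NOT proved here; it needs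
Riemannian transport inequalities on `SU(N)` absent from Mathlib): `r` the bi-invariant
Riemannian distance, for which the one-link potential has `|Hess| ≤ 2(d-1)N|β||v|²` (the
one-link case of Shen–Zhu–Zhu Lemma 4.1, whose all-link bound is `8(d-1)N|β||v|²`) against
`Ric = (N/2)|v|²` (their Assumption 1.1 for `SU(N)`), so that the Bakry–Émery constant
`N(1/2 - 2(d-1)|β|)` and the `N|β|`-Lipschitz dependence of the potential on one staple link give
`C x y = |β|/(1/2 - 2(d-1)|β|)` uniformly in `N`; with `|linkPlaqNbr x| = 6(d-1)` the Dobrushin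
constant is `6(d-1)|β|/(1/2 - 2(d-1)|β|) < 1 ⟺ |β| < 1/(16(d-1))` — exactly Shen–Zhu–Zhu's
Assumption 1.1.

## References

* H. Shen, R. Zhu, X. Zhu, *A stochastic analysis approach to lattice Yang–Mills at strong
  coupling*, CMP 400 (2023) 805–851, arXiv:2204.12737 (numbers and pages of arXiv v1): Assumption
  1.1 (p. 4), Thm. 1.2, Rem. 1.3 (p. 5) and the unnumbered remark following it (Dobrushin route,
  p. 6), Cor. 1.6 "Mass gap" (p. 7), Lemma 4.1 (p. 17).
* H. Föllmer, *Random fields and diffusion processes*, Saint-Flour XV–XVII, LNM 1362 (1988),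
  Ch. I, §2, Remark (2.17)–(2.24).
* R. L. Dobrushin, Theory Probab. Appl. 15 (1970) 458–486.
* E. Seiler, LNP 159 (1982), Ch. 2 (finite range of the Wilson specification).
-/

noncomputable section

open MeasureTheory Filter Topology ProbabilityTheory Function
open scoped NNReal
open Literature.Probability.LatticeModels
open Literature.Probability.LatticeModels.DobrushinMetric
open Literature.MathematicalPhysics.QuantumLattice

namespace Literature.MathematicalPhysics.QuantumFieldTheory

variable {d N : ℕ} {G : Type*} [Group G]

/-! ### Plaquette neighbours of a link -/

/-- The **plaquette neighbours** of the link `e`: the links other than `e` of the plaquettes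
containing `e` (`2(d-1)` plaquettes, `6(d-1)` links). This is the range of the one-link
conditional law of the Wilson specification (Seiler LNP 159 Ch. 2; Shen–Zhu–Zhu CMP 400 (2023)
§2, "`p ≻ e`"). [folklore] -/
def linkPlaqNbr (e : ZdEdge d) : Finset (ZdEdge d) :=
  ((plaquettesTouching {e}).biUnion plaquetteEdges).erase e

/-- A link is not its own plaquette neighbour. [folklore] -/
theorem not_mem_linkPlaqNbr (e : ZdEdge d) : e ∉ linkPlaqNbr e :=
  Finset.notMem_erase e _

/-- `y` is a plaquette neighbour of `e` iff `y ≠ e` and some plaquette contains both. [folklore] -/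
theorem mem_linkPlaqNbr_iff {e y : ZdEdge d} :
    y ∈ linkPlaqNbr e ↔ y ≠ e ∧ ∃ p : ZdPlaquette d, e ∈ plaquetteEdges p ∧ y ∈ plaquetteEdges p := by
  simp only [linkPlaqNbr, Finset.mem_erase, Finset.mem_biUnion, mem_plaquettesTouching_iff]
  refine and_congr_right fun _ => ⟨?_, ?_⟩
  · rintro ⟨p, ⟨z, hz⟩, hy⟩
    obtain ⟨hz1, hz2⟩ := Finset.mem_inter.1 hz
    rw [Finset.mem_singleton] at hz2
    exact ⟨p, hz2 ▸ hz1, hy⟩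
  · rintro ⟨p, he, hy⟩
    exact ⟨p, ⟨e, Finset.mem_inter.2 ⟨he, Finset.mem_singleton_self e⟩⟩, hy⟩

/-- The base point of a link of the plaquette `p = (x, i < j)` is `x`, `x + eᵢ` or `x + eⱼ`:
coordinatewise it exceeds `x` by `0` or `1`. [folklore] -/
theorem apply_sub_eq_zero_or_one_of_mem_plaquetteEdges {p : ZdPlaquette d} {e : ZdEdge d}
    (he : e ∈ plaquetteEdges p) (k : Fin d) : e.1 k - p.1 k = 0 ∨ e.1 k - p.1 k = 1 := by
  simp only [plaquetteEdges, Finset.mem_insert, Finset.mem_singleton] at he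
  rcases he with rfl | rfl | rfl | rfl
  · exact Or.inl (by simp)
  · by_cases hk : k = p.2.1.1
    · subst hk; exact Or.inr (by simp)
    · exact Or.inl (by simp [hk])
  · by_cases hk : k = p.2.1.2
    · subst hk; exact Or.inr (by simp)
    · exact Or.inl (by simp [hk])
  · exact Or.inl (by simp)

/-- Two links of one plaquette have base points at `ℓ^∞`-distance at most `1`. [folklore] -/
theorem norm_sub_le_one_of_mem_plaquetteEdges {p : ZdPlaquette d} {e y : ZdEdge d}
    (he : e ∈ plaquetteEdges p) (hy : y ∈ plaquetteEdges p) : ‖e.1 - y.1‖ ≤ (1 : ℝ) := by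
  refine (pi_norm_le_iff_of_nonneg zero_le_one).2 fun k => ?_
  rw [Pi.sub_apply, Int.norm_eq_abs, Int.cast_sub]
  have h1 := apply_sub_eq_zero_or_one_of_mem_plaquetteEdges he k
  have h2 := apply_sub_eq_zero_or_one_of_mem_plaquetteEdges hy k
  have : ((e.1 k : ℤ) : ℝ) - (y.1 k : ℝ) = ((e.1 k - p.1 k : ℤ) : ℝ) - ((y.1 k - p.1 k : ℤ) : ℝ) := by
    push_cast; ring
  rw [this]
  rcases h1 with h1 | h1 <;> rcases h2 with h2 | h2 <;> rw [h1, h2] <;> norm_num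

/-- Plaquette neighbours have base points at `ℓ^∞`-distance at most `1`. [folklore] -/
theorem norm_sub_le_one_of_mem_linkPlaqNbr {e y : ZdEdge d} (hy : y ∈ linkPlaqNbr e) :
    ‖e.1 - y.1‖ ≤ (1 : ℝ) := by
  obtain ⟨-, p, he, hy⟩ := mem_linkPlaqNbr_iff.1 hy
  exact norm_sub_le_one_of_mem_plaquetteEdges he hy

/-! ### Counting plaquette neighbours: `|linkPlaqNbr e| ≤ 6(d-1)` -/

section Card

/-- A plaquette touches `{e}` iff it contains `e`. [folklore] -/
theorem mem_plaquettesTouching_singleton {e : ZdEdge d} {p : ZdPlaquette d} :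
    p ∈ plaquettesTouching {e} ↔ e ∈ plaquetteEdges p := by
  rw [mem_plaquettesTouching_iff]
  constructor
  · rintro ⟨z, hz⟩
    obtain ⟨hz1, hz2⟩ := Finset.mem_inter.1 hz
    rw [Finset.mem_singleton] at hz2
    exact hz2 ▸ hz1
  · intro he
    exact ⟨e, Finset.mem_inter.2 ⟨he, Finset.mem_singleton_self e⟩⟩

/-- The direction of the plaquette `p` other than that of the link `e` (bookkeeping for the
count of plaquettes through a link). [folklore] -/
def plaqOtherDir (e : ZdEdge d) (p : ZdPlaquette d) : Fin d :=
  if p.2.1.1 = e.2 then p.2.1.2 else p.2.1.1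

/-- Whether the plaquette `p` is based at the base point of the link `e`. [folklore] -/
def plaqSide (e : ZdEdge d) (p : ZdPlaquette d) : Bool :=
  decide (p.1 = e.1)

/-- Reconstruction of (the data of) a plaquette through `e` from its other direction and its
side. [folklore] -/
def plaqRecover (e : ZdEdge d) (mb : Fin d × Bool) : (Fin d → ℤ) × (Fin d × Fin d) :=
  (if mb.2 then e.1 else e.1 - Pi.single mb.1 1, (min e.2 mb.1, max e.2 mb.1))

/-- A plaquette containing the link `e` is determined by its other direction and its side:
the four ways a link lies on a plaquette. [folklore] -/
theorem plaqRecover_eq {e : ZdEdge d} {p : ZdPlaquette d} (he : e ∈ plaquetteEdges p) :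
    plaqRecover e (plaqOtherDir e p, plaqSide e p) = (p.1, p.2.1) := by
  have hij : p.2.1.1 < p.2.1.2 := p.2.2
  have hne : p.2.1.1 ≠ p.2.1.2 := hij.ne
  simp only [plaquetteEdges, Finset.mem_insert, Finset.mem_singleton] at he
  rcases he with rfl | rfl | rfl | rfl
  · simp [plaqRecover, plaqOtherDir, plaqSide, min_eq_left hij.le, max_eq_right hij.le]
  · simp [plaqRecover, plaqOtherDir, plaqSide, hne, min_eq_right hij.le, max_eq_left hij.le]
  · simp [plaqRecover, plaqOtherDir, plaqSide, min_eq_left hij.le, max_eq_right hij.le]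
  · simp [plaqRecover, plaqOtherDir, plaqSide, hne, min_eq_right hij.le, max_eq_left hij.le]

/-- The other direction of a plaquette differs from the direction of `e`. [folklore] -/
theorem plaqOtherDir_ne (e : ZdEdge d) (p : ZdPlaquette d) : plaqOtherDir e p ≠ e.2 := by
  have hne : p.2.1.1 ≠ p.2.1.2 := (p.2.2).ne
  unfold plaqOtherDir
  split_ifs with h
  · exact fun h' => hne (h.trans h'.symm)
  · exact h

/-- **At most `2(d-1)` plaquettes contain a given link** (one for each other direction and each
side). [folklore] -/
theorem card_plaquettesTouching_singleton_le (e : ZdEdge d) :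
    (plaquettesTouching {e}).card ≤ 2 * (d - 1) := by
  classical
  have hmaps : ∀ p ∈ plaquettesTouching {e},
      (plaqOtherDir e p, plaqSide e p) ∈ (Finset.univ.erase e.2) ×ˢ (Finset.univ : Finset Bool) :=
    fun p _ => Finset.mem_product.2
      ⟨Finset.mem_erase.2 ⟨plaqOtherDir_ne e p, Finset.mem_univ _⟩, Finset.mem_univ _⟩
  have hinj : Set.InjOn (fun p => (plaqOtherDir e p, plaqSide e p))
      ↑(plaquettesTouching {e}) := by
    intro p hp p' hp' h
    have h1 := plaqRecover_eq (mem_plaquettesTouching_singleton.1 (Finset.mem_coe.1 hp))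
    have h2 := plaqRecover_eq (mem_plaquettesTouching_singleton.1 (Finset.mem_coe.1 hp'))
    have h12 : (p.1, p.2.1) = (p'.1, p'.2.1) := by
      rw [← h1, ← h2]
      exact congrArg (plaqRecover e) h
    obtain ⟨hfst, hsnd⟩ := Prod.mk.inj h12
    exact Prod.ext hfst (Subtype.ext hsnd)
  calc (plaquettesTouching {e}).card
      ≤ ((Finset.univ.erase e.2) ×ˢ (Finset.univ : Finset Bool)).card :=
        Finset.card_le_card_of_injOn _ hmaps hinj
    _ = 2 * (d - 1) := by
        rw [Finset.card_product, Finset.card_erase_of_mem (Finset.mem_univ _), Finset.card_univ,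
          Fintype.card_fin, Finset.card_univ, Fintype.card_bool]
        ring

/-- A plaquette has at most four links. [folklore] -/
theorem card_plaquetteEdges_le (p : ZdPlaquette d) : (plaquetteEdges p).card ≤ 4 := by
  unfold plaquetteEdges
  refine (Finset.card_insert_le _ _).trans ?_
  refine (Nat.succ_le_succ (Finset.card_insert_le _ _)).trans ?_
  refine (Nat.succ_le_succ (Nat.succ_le_succ (Finset.card_insert_le _ _))).trans ?_
  simp

/-- **A link has at most `6(d-1)` plaquette neighbours** (three other links on each of the at
most `2(d-1)` plaquettes through it) (Shen–Zhu–Zhu CMP 400 (2023) §2). [folklore] -/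
theorem card_linkPlaqNbr_le (e : ZdEdge d) : (linkPlaqNbr e).card ≤ 6 * (d - 1) := by
  classical
  have hsub : linkPlaqNbr e ⊆ (plaquettesTouching {e}).biUnion fun p => (plaquetteEdges p).erase e := by
    intro x hx
    obtain ⟨hxe, hx⟩ := Finset.mem_erase.1 hx
    obtain ⟨p, hp, hxp⟩ := Finset.mem_biUnion.1 hx
    exact Finset.mem_biUnion.2 ⟨p, hp, Finset.mem_erase.2 ⟨hxe, hxp⟩⟩
  have hthree : ∀ p ∈ plaquettesTouching {e}, ((plaquetteEdges p).erase e).card ≤ 3 := fun p hp => by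
    rw [Finset.card_erase_of_mem (mem_plaquettesTouching_singleton.1 hp)]
    have := card_plaquetteEdges_le p
    omega
  calc (linkPlaqNbr e).card
      ≤ ((plaquettesTouching {e}).biUnion fun p => (plaquetteEdges p).erase e).card :=
        Finset.card_le_card hsub
    _ ≤ ∑ p ∈ plaquettesTouching {e}, ((plaquetteEdges p).erase e).card := Finset.card_biUnion_le
    _ ≤ ∑ _p ∈ plaquettesTouching {e}, 3 := Finset.sum_le_sum hthree
    _ = 3 * (plaquettesTouching {e}).card := by rw [Finset.sum_const, smul_eq_mul, mul_comm]
    _ ≤ 3 * (2 * (d - 1)) := Nat.mul_le_mul_left 3 (card_plaquettesTouching_singleton_le e)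
    _ = 6 * (d - 1) := by ring

end Card

/-! ### Finite range of the one-link conditional law -/

section YM

variable [TopologicalSpace G] [IsTopologicalGroup G] [CompactSpace G] [MeasurableSpace G]
  [BorelSpace G] [SecondCountableTopology G] (ρ : G →* Matrix (Fin N) (Fin N) ℂ)

/-- **The one-link conditional law as a tilted Haar measure**: the law of `U_e` under
`γ_{e}(· | η)` is the push-forward along `ζ ↦ ζ_e` of the product Haar measure on `G^{e}` tilted
by `-β S_{e}(ζ η_{eᶜ})` (change of variables `map_tilted_comp`). (Seiler LNP 159 Ch. 2;
Shen–Zhu–Zhu CMP 400 (2023) (1.2).) [folklore] -/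
theorem siteLaw_ymSpecification_eq (hρ : Continuous ρ) (β : ℝ) (e : ZdEdge d) (η : LGConfig d G) :
    siteLaw (ymSpecification ρ β) e η =
      ((Measure.pi fun _ : ↥({e} : Finset (ZdEdge d)) => haarProbability G).tilted
        ((fun U => -β * wilsonBoundaryAction ρ {e} U) ∘ fun ζ => glueWith {e} ζ η)).map
        (fun ζ => ζ ⟨e, Finset.mem_singleton_self e⟩) := by
  have hF : Measurable fun U : LGConfig d G => -β * wilsonBoundaryAction ρ {e} U :=
    (continuous_const.mul (continuous_wilsonBoundaryAction ρ hρ {e})).measurable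
  have h1 : ymSpecification ρ β {e} η =
      ((Measure.pi fun _ : ↥({e} : Finset (ZdEdge d)) => haarProbability G).tilted
        ((fun U => -β * wilsonBoundaryAction ρ {e} U) ∘ fun ζ => glueWith {e} ζ η)).map
        (fun ζ => glueWith {e} ζ η) := by
    rw [map_tilted_comp _ (measurable_glueWith _ η) hF]
    rfl
  rw [siteLaw, h1, Measure.map_map (measurable_pi_apply e) (measurable_glueWith _ η)]
  congr 1
  funext ζ
  simp [Function.comp]

/-- **The one-link conditional law is the single-link Gibbs measure**
`ν_{e,ω}(dg) = Z⁻¹ exp(-β S_{e}(ω^{e ← g})) dg` (Haar measure `dg`): the form in which the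
one-link estimate left open by `shen_zhu_zhu_of_dobrushinCondition` has to be attacked
(Shen–Zhu–Zhu CMP 400 (2023) (1.2) restricted to one link; Seiler LNP 159 Ch. 2). Proof: on the
one-point index set gluing is `Function.update ω e ∘ eval`, push-forward commutes with tilting
(`map_tilted_comp`) and `eval` pushes the one-fold product of Haar measure to Haar measure
(`measurePreserving_eval`). [folklore] -/
theorem siteLaw_ymSpecification_eq_tilted_haar [DecidableEq (ZdEdge d)] (hρ : Continuous ρ)
    (β : ℝ) (e : ZdEdge d) (ω : LGConfig d G) :
    siteLaw (ymSpecification ρ β) e ω =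
      (haarProbability G).tilted fun g => -β * wilsonBoundaryAction ρ {e} (Function.update ω e g) := by
  rw [siteLaw_ymSpecification_eq ρ hρ β e ω]
  have hF : Measurable fun U : LGConfig d G => -β * wilsonBoundaryAction ρ {e} U :=
    (continuous_const.mul (continuous_wilsonBoundaryAction ρ hρ {e})).measurable
  have hgl : (fun ζ : ↥({e} : Finset (ZdEdge d)) → G => glueWith {e} ζ ω) =
      Function.update ω e ∘ fun ζ => ζ ⟨e, Finset.mem_singleton_self e⟩ := by
    funext ζ z
    by_cases hz : z = e
    · subst hz
      simp
    · rw [Function.comp_apply, Function.update_of_ne hz,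
        glueWith_apply_not_mem _ _ _ (by simpa using hz)]
  have hcomp : ((fun U : LGConfig d G => -β * wilsonBoundaryAction ρ {e} U) ∘
        fun ζ : ↥({e} : Finset (ZdEdge d)) → G => glueWith {e} ζ ω) =
      (fun g => -β * wilsonBoundaryAction ρ {e} (Function.update ω e g)) ∘
        fun ζ : ↥({e} : Finset (ZdEdge d)) → G => ζ ⟨e, Finset.mem_singleton_self e⟩ := by
    rw [hgl]
    rfl
  have hF' : Measurable fun g : G => -β * wilsonBoundaryAction ρ {e} (Function.update ω e g) :=
    hF.comp (measurable_update ω)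
  have hev : (Measure.pi fun _ : ↥({e} : Finset (ZdEdge d)) => haarProbability G).map
      (fun ζ => ζ ⟨e, Finset.mem_singleton_self e⟩) = haarProbability G :=
    (MeasureTheory.measurePreserving_eval (fun _ : ↥({e} : Finset (ZdEdge d)) =>
      haarProbability G) ⟨e, Finset.mem_singleton_self e⟩).map_eq
  have key := map_tilted_comp (Measure.pi fun _ : ↥({e} : Finset (ZdEdge d)) => haarProbability G)
    (measurable_pi_apply (⟨e, Finset.mem_singleton_self e⟩ : ↥({e} : Finset (ZdEdge d)))) hF'
  rw [hev] at key
  rw [hcomp]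
  exact key

/-- **Finite range of the Wilson specification at one link**: the conditional law of `U_e` given
the other links depends on them only through the plaquette neighbours of `e` — the tilting
density `exp(-β S_{e})` reads the configuration only on the plaquettes through `e`
(`isCylinder_wilsonBoundaryAction_holds`) (Seiler LNP 159 Ch. 2; Shen–Zhu–Zhu CMP 400 (2023) §2).
[cite: SeilerLNP1982, Ch. 2 (lattice gauge theories: locality and gauge covariance of the Wilson specification)] -/
theorem siteLaw_ymSpecification_congr (hρ : Continuous ρ) (β : ℝ) (e : ZdEdge d)
    {η η' : LGConfig d G} (h : ∀ z ∈ linkPlaqNbr e, η z = η' z) :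
    siteLaw (ymSpecification ρ β) e η = siteLaw (ymSpecification ρ β) e η' := by
  rw [siteLaw_ymSpecification_eq ρ hρ β e η, siteLaw_ymSpecification_eq ρ hρ β e η']
  congr 2
  funext ζ
  simp only [Function.comp_apply]
  congr 1
  refine isCylinder_wilsonBoundaryAction_holds ρ {e} fun z hz => ?_
  by_cases hze : z = e
  · subst hze
    rw [glueWith_apply_mem _ _ _ (Finset.mem_singleton_self z),
      glueWith_apply_mem _ _ _ (Finset.mem_singleton_self z)]
  · have hz' : z ∉ ({e} : Finset (ZdEdge d)) := by simpa using hze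
    rw [glueWith_apply_not_mem _ _ _ hz', glueWith_apply_not_mem _ _ _ hz']
    exact h z (Finset.mem_erase.2 ⟨hze, hz⟩)

/-- **Dobrushin's condition for the Wilson specification reduces to the one-link
Kantorovich–Rubinstein contraction** (Föllmer 1988, Ch. I, (2.20) with the finite range of the
Wilson specification; Shen–Zhu–Zhu CMP 400 (2023), remark after Rem. 1.3): given nonnegative
influence coefficients `C` and the one-link contraction estimate for plaquette neighbours, the
Wilson specification satisfies `IsKRContraction` with `nbr = linkPlaqNbr`.
[cite: Follmer1988, Ch. I (2.20)] -/
theorem isKRContraction_ymSpecification (hρ : Continuous ρ) (β : ℝ) {r : G → G → ℝ}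
    {C : ZdEdge d → ZdEdge d → ℝ} (hC0 : ∀ x y, 0 ≤ C x y)
    (hcontr : ∀ (x : ZdEdge d), ∀ y ∈ linkPlaqNbr x, ∀ (ω η : LGConfig d G),
      (∀ z, z ≠ y → ω z = η z) → ∀ (φ : G → ℝ) (L : ℝ), Measurable φ → (∃ M, ∀ s, |φ s| ≤ M) →
        0 ≤ L → (∀ a b, |φ a - φ b| ≤ L * r a b) →
        |∫ s, φ s ∂(siteLaw (ymSpecification ρ β) x ω) -
            ∫ s, φ s ∂(siteLaw (ymSpecification ρ β) x η)| ≤ C x y * L * r (ω y) (η y)) :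
    IsKRContraction (ymSpecification (d := d) ρ β) r linkPlaqNbr C :=
  ⟨not_mem_linkPlaqNbr, hC0, fun x _ _ h => siteLaw_ymSpecification_congr ρ hρ β x h, hcontr⟩

end YM

/-! ### `SU(N)`: the entry metric and Lipschitz cylinder functions -/

section SU

/-- The matrix entries of an element of `SU(N)`, as a point of the sup-metric space
`Fin N → Fin N → ℂ` (the metric implicit in `IsLipschitzCylinder`). [folklore] -/
def suEntries (U : Matrix.specialUnitaryGroup (Fin N) ℂ) : Fin N → Fin N → ℂ :=
  fun i j => (U : Matrix (Fin N) (Fin N) ℂ) i j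

/-- The entry map is continuous (it is the subtype inclusion). [folklore] -/
theorem continuous_suEntries : Continuous (suEntries (N := N)) :=
  continuous_pi fun i => continuous_pi fun j => continuous_subtype_val.matrix_elem i j

/-- The entry map is measurable. [folklore] -/
theorem measurable_suEntries : Measurable (suEntries (N := N)) :=
  continuous_suEntries.measurable

/-- **The Borel σ-algebra of `SU(N)` is induced by the matrix entries** (the topology of
`SU(N) ⊆ M_N(ℂ)` is the subspace topology; Mathlib `borel_comap`). [folklore] -/
theorem measurableSpace_specialUnitaryGroup_eq_comap :
    (inferInstance : MeasurableSpace (Matrix.specialUnitaryGroup (Fin N) ℂ)) =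
      MeasurableSpace.comap suEntries (inferInstance : MeasurableSpace (Fin N → Fin N → ℂ)) := by
  change borel _ = _
  rw [BorelSpace.measurable_eq (α := Fin N → Fin N → ℂ), ← borel_comap]
  rfl

/-- Entries of special unitary matrices have modulus `≤ 1`. [folklore] -/
theorem norm_suEntries_le (U : Matrix.specialUnitaryGroup (Fin N) ℂ) (i j : Fin N) :
    ‖suEntries U i j‖ ≤ 1 :=
  entry_norm_bound_of_unitary (Matrix.specialUnitaryGroup_le_unitaryGroup U.2) i j

/-- The entry metric on `SU(N)` is bounded by `2`. [folklore] -/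
theorem dist_suEntries_le_two (a b : Matrix.specialUnitaryGroup (Fin N) ℂ) :
    dist (suEntries a) (suEntries b) ≤ 2 := by
  refine (dist_pi_le_iff (by norm_num)).2 fun i => (dist_pi_le_iff (by norm_num)).2 fun j => ?_
  calc dist (suEntries a i j) (suEntries b i j) ≤ ‖suEntries a i j‖ + ‖suEntries b i j‖ :=
        dist_le_norm_add_norm _ _
    _ ≤ 1 + 1 := add_le_add (norm_suEntries_le a i j) (norm_suEntries_le b i j)
    _ = 2 := by norm_num

variable {F : LGConfig d (Matrix.specialUnitaryGroup (Fin N) ℂ) → ℝ} {Λ : Finset (ZdEdge d)}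
  {K : ℝ≥0}

/-- A Lipschitz cylinder function for the fundamental representation factors through the entry
tuple `(suEntries (U e))_{e ∈ Λ}`. [folklore] -/
theorem IsLipschitzCylinder.exists_suEntries (h : IsLipschitzCylinder (fundamentalRep (Fin N)) F Λ K) :
    ∃ f : (↥Λ → Fin N → Fin N → ℂ) → ℝ, LipschitzWith K f ∧
      ∀ U, F U = f fun e => suEntries (U e) := by
  obtain ⟨f, hf, hF⟩ := h
  exact ⟨f, hf, fun U => by rw [hF]; rfl⟩

/-- The entry tuple of a configuration is measurable. [folklore] -/
theorem measurable_suEntries_tuple (Λ : Finset (ZdEdge d)) :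
    Measurable fun (U : LGConfig d (Matrix.specialUnitaryGroup (Fin N) ℂ)) (e : ↥Λ) =>
      suEntries (U e) :=
  measurable_pi_lambda _ fun e => measurable_suEntries.comp (measurable_pi_apply (e : ZdEdge d))

/-- A Lipschitz cylinder function is measurable. [folklore] -/
theorem IsLipschitzCylinder.measurable (h : IsLipschitzCylinder (fundamentalRep (Fin N)) F Λ K) :
    Measurable F := by
  obtain ⟨f, hf, hF⟩ := h.exists_suEntries
  have : F = f ∘ fun U (e : ↥Λ) => suEntries (U e) := funext hF
  rw [this]
  exact hf.continuous.measurable.comp (measurable_suEntries_tuple Λ)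

/-- A Lipschitz cylinder function is bounded: `|F U| ≤ |F 1| + 2K` (the entry tuples lie in a
set of diameter `≤ 2`). [folklore] -/
theorem IsLipschitzCylinder.abs_le (h : IsLipschitzCylinder (fundamentalRep (Fin N)) F Λ K)
    (U : LGConfig d (Matrix.specialUnitaryGroup (Fin N) ℂ)) : |F U| ≤ |F 1| + 2 * K := by
  obtain ⟨f, hf, hF⟩ := h.exists_suEntries
  have hdist : dist (fun e : ↥Λ => suEntries (U e)) (fun e : ↥Λ => suEntries ((1 : LGConfig d _) e)) ≤ 2 :=
    (dist_pi_le_iff (by norm_num)).2 fun e => dist_suEntries_le_two _ _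
  have hlip := hf.dist_le_mul (fun e : ↥Λ => suEntries (U e)) (fun e : ↥Λ => suEntries ((1 : LGConfig d _) e))
  rw [Real.dist_eq, ← hF, ← hF] at hlip
  have hK : (0 : ℝ) ≤ K := K.2
  calc |F U| = |F 1 + (F U - F 1)| := by ring_nf
    _ ≤ |F 1| + |F U - F 1| := abs_add_le _ _
    _ ≤ |F 1| + K * 2 := add_le_add le_rfl (hlip.trans (mul_le_mul_of_nonneg_left hdist hK))
    _ = |F 1| + 2 * K := by ring

/-- A Lipschitz cylinder function depends only on the links of its support. [folklore] -/
theorem IsLipschitzCylinder.dependsOn (h : IsLipschitzCylinder (fundamentalRep (Fin N)) F Λ K) :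
    DependsOn F (↑Λ : Set (ZdEdge d)) :=
  h.isCylinder

/-- **Lipschitz cylinder functions have coordinatewise Lipschitz constant `K` for the entry
metric**, hence `A K` for any weight `r` on `SU(N)` with `dist(entries) ≤ A r` (the sup metric on
tuples: configurations differing at one link `y ∈ Λ` have entry tuples at distance
`dist(entries(σ_y), entries(τ_y))`). This is how the observables of `shen_zhu_zhu` enter the
Dobrushin machinery. [folklore] -/
theorem IsLipschitzCylinder.isLipBound (h : IsLipschitzCylinder (fundamentalRep (Fin N)) F Λ K)
    {r : Matrix.specialUnitaryGroup (Fin N) ℂ → Matrix.specialUnitaryGroup (Fin N) ℂ → ℝ}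
    {A : ℝ} (hA0 : 0 ≤ A)
    (hA : ∀ a b, dist (suEntries a) (suEntries b) ≤ A * r a b) :
    IsLipBound r F fun y => if y ∈ Λ then A * K else 0 := by
  classical
  obtain ⟨f, hf, hF⟩ := h.exists_suEntries
  refine ⟨fun y => by split_ifs <;> positivity, fun y σ τ hστ => ?_⟩
  split_ifs with hy
  · have hdist : dist (fun e : ↥Λ => suEntries (σ e)) (fun e : ↥Λ => suEntries (τ e)) ≤
        dist (suEntries (σ y)) (suEntries (τ y)) := by
      refine (dist_pi_le_iff dist_nonneg).2 fun e => ?_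
      by_cases hey : (e : ZdEdge d) = y
      · rw [hey]
      · rw [hστ e hey, dist_self]
        exact dist_nonneg
    have hlip := hf.dist_le_mul (fun e : ↥Λ => suEntries (σ e)) (fun e : ↥Λ => suEntries (τ e))
    rw [Real.dist_eq, ← hF, ← hF] at hlip
    have hK : (0 : ℝ) ≤ K := K.2
    calc |F σ - F τ| ≤ K * dist (fun e : ↥Λ => suEntries (σ e)) (fun e : ↥Λ => suEntries (τ e)) :=
          hlip
      _ ≤ K * (A * r (σ y) (τ y)) :=
          mul_le_mul_of_nonneg_left (hdist.trans (hA _ _)) hK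
      _ = A * K * r (σ y) (τ y) := by ring
  · rw [h.dependsOn (fun x hx => hστ x (fun h' => hy (h' ▸ Finset.mem_coe.1 hx))), sub_self,
      abs_zero, zero_mul]

end SU

/-! ### The distance profile of the covariance estimate -/

section Profile

/-- The `ℓ^∞` base-point distance from the link `y` to the finite link set `Λ` (junk value `0`
for `Λ = ∅`); its integer part is the profile `ℓ` fed to the Dobrushin comparison estimate.
[folklore] -/
def linkSetDist (Λ : Finset (ZdEdge d)) (y : ZdEdge d) : ℝ :=
  if h : Λ.Nonempty then Λ.inf' h (fun y' => ‖y.1 - y'.1‖) else 0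

/-- `linkSetDist ≥ 0`. [folklore] -/
theorem linkSetDist_nonneg (Λ : Finset (ZdEdge d)) (y : ZdEdge d) : 0 ≤ linkSetDist Λ y := by
  unfold linkSetDist
  split_ifs with h
  · exact (Finset.le_inf'_iff h _).2 fun y' _ => norm_nonneg _
  · exact le_rfl

/-- The distance from a link of `Λ` to `Λ` is `0`. [folklore] -/
theorem linkSetDist_eq_zero_of_mem {Λ : Finset (ZdEdge d)} {y : ZdEdge d} (hy : y ∈ Λ) :
    linkSetDist Λ y = 0 := by
  refine le_antisymm ?_ (linkSetDist_nonneg Λ y)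
  unfold linkSetDist
  rw [dif_pos ⟨y, hy⟩]
  exact (Finset.inf'_le _ hy).trans (by simp)

/-- Plaquette neighbours are at distance `≤ 1`, so the distance to `Λ` changes by at most `1`
along them (triangle inequality for the `ℓ^∞` norm of base points). [folklore] -/
theorem linkSetDist_le_add_one {Λ : Finset (ZdEdge d)} {x y : ZdEdge d} (hxy : y ∈ linkPlaqNbr x) :
    linkSetDist Λ x ≤ linkSetDist Λ y + 1 := by
  unfold linkSetDist
  split_ifs with h
  · have key : ∀ y' ∈ Λ, Λ.inf' h (fun y' => ‖x.1 - y'.1‖) - 1 ≤ ‖y.1 - y'.1‖ := fun y' hy' => by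
      have h1 : Λ.inf' h (fun y' => ‖x.1 - y'.1‖) ≤ ‖x.1 - y'.1‖ := Finset.inf'_le _ hy'
      have h2 : ‖x.1 - y'.1‖ ≤ ‖x.1 - y.1‖ + ‖y.1 - y'.1‖ := norm_sub_le_norm_sub_add_norm_sub _ _ _
      have h3 := norm_sub_le_one_of_mem_linkPlaqNbr hxy
      linarith
    have := (Finset.le_inf'_iff h _).2 key
    linarith
  · simp

/-- The set-to-set distance is at most the distance of any pair of links. [folklore] -/
theorem setDistEdges_le_norm_sub {Λ₁ Λ₂ : Finset (ZdEdge d)} {y y' : ZdEdge d} (hy : y ∈ Λ₁)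
    (hy' : y' ∈ Λ₂) : setDistEdges Λ₁ Λ₂ ≤ ‖y.1 - y'.1‖ := by
  have hmem : (y, y') ∈ Λ₁ ×ˢ Λ₂ := Finset.mem_product.2 ⟨hy, hy'⟩
  have hp : (Λ₁ ×ˢ Λ₂).Nonempty := ⟨(y, y'), hmem⟩
  rw [setDistEdges, dif_pos hp]
  exact Finset.inf'_le (fun p : ZdEdge d × ZdEdge d => ‖p.1.1 - p.2.1‖) hmem

/-- For `Λ₂ = ∅` the set-to-set distance is the junk value `0`. [folklore] -/
theorem setDistEdges_of_not_nonempty {Λ₁ Λ₂ : Finset (ZdEdge d)} (h₂ : ¬ Λ₂.Nonempty) :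
    setDistEdges Λ₁ Λ₂ = 0 := by
  have hp : ¬ (Λ₁ ×ˢ Λ₂).Nonempty := fun ⟨p, hp⟩ => h₂ ⟨p.2, (Finset.mem_product.1 hp).2⟩
  rw [setDistEdges, dif_neg hp]

/-- The set-to-set distance `setDistEdges Λ₁ Λ₂` is at most the distance from any link of `Λ₁`
to `Λ₂`. [folklore] -/
theorem setDistEdges_le_linkSetDist {Λ₁ Λ₂ : Finset (ZdEdge d)} {y : ZdEdge d} (hy : y ∈ Λ₁) :
    setDistEdges Λ₁ Λ₂ ≤ linkSetDist Λ₂ y := by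
  unfold linkSetDist
  split_ifs with h₂
  · exact (Finset.le_inf'_iff h₂ _).2 fun y' hy' => setDistEdges_le_norm_sub hy hy'
  · rw [setDistEdges_of_not_nonempty h₂]

end Profile

/-! ### The Shen–Zhu–Zhu reduction -/

section Reduction

/-- **`shen_zhu_zhu` from Dobrushin's condition in the Vasserstein form for the one-link laws**
(the Dobrushin route named by Shen–Zhu–Zhu, CMP 400 (2023), remark after Rem. 1.3; Föllmer 1988,
Ch. I, Remark (2.17)–(2.24); Dobrushin 1970). Suppose that for `2 ≤ d`, `2 ≤ N` and every 't Hooft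
coupling `|β| < 1/(16(d-1))` there are: a weight `r` on `SU(N)` with `0 ≤ r ≤ R`, dominating the
matrix-entry metric up to a constant `A` (any metric equivalent to or stronger than the entry
metric qualifies, e.g. the bi-invariant Riemannian distance), and influence coefficients
`C ≥ 0` with Dobrushin constant `sup_x ∑_{y ∈ linkPlaqNbr x} C x y ≤ c < 1`, such that the
conditional laws of the link variable `U_x` under the `SU(N)` Wilson specification at bare
coupling `N β` (`siteLaw (ymSpecification (fundamentalRep (Fin N)) (N * β)) x`) for boundary
conditions differing only at the plaquette-neighbour `y` are `C x y · r(ω_y, η_y)`-close in the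
Kantorovich–Rubinstein distance dual to `r` (tested on bounded measurable `r`-Lipschitz `φ`).
Then `shen_zhu_zhu d N` holds: (i) `|𝒢| = 1` (uniqueness by
`subsingleton_gibbsMeasures_of_isKRContraction`, existence by `shen_zhu_zhu_nonempty`), and
(ii) for every DLR state and all Lipschitz cylinder functions,
`|cov(F₁, F₂)| ≤ c₁ e^{-κ d(Λ₁, Λ₂)} (K₁ K₂ + ‖F₁‖₂ ‖F₂‖₂)` with `κ = -log max(c, 1/2) > 0` and
`c₁ = 2 R² A² n² e^{κ}` (`abs_covariance_le_of_isKRContraction` with the profile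
`⌊linkSetDist Λ₂⌋`). With `r` the Riemannian distance and `C x y = κ_β := |β|/(1/2 - 2(d-1)|β|)`
(one-link Bakry–Émery constant, Shen–Zhu–Zhu Lemma 4.1), the Dobrushin constant is
`6(d-1) κ_β < 1 ⟺ |β| < 1/(16(d-1))`, Shen–Zhu–Zhu's Assumption 1.1; that one-link estimate is
the hypothesis left open here. [cite: arXiv220412737, Rem. 1.3 ff. (Dobrushin route, p. 6) with Thm. 1.2 and Cor. 1.6 (Mass gap)] -/
theorem shen_zhu_zhu_of_dobrushinCondition
    (hDob : 2 ≤ d → 2 ≤ N → ∀ β : ℝ, |β| < 1 / (16 * ((d : ℝ) - 1)) →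
      ∃ (r : Matrix.specialUnitaryGroup (Fin N) ℂ → Matrix.specialUnitaryGroup (Fin N) ℂ → ℝ)
        (R A c : ℝ) (C : ZdEdge d → ZdEdge d → ℝ),
        (∀ a b, 0 ≤ r a b) ∧ (∀ a b, r a b ≤ R) ∧ 0 ≤ A ∧
        (∀ a b, dist (suEntries a) (suEntries b) ≤ A * r a b) ∧
        (∀ x y, 0 ≤ C x y) ∧ c < 1 ∧ (∀ x, ∑ y ∈ linkPlaqNbr x, C x y ≤ c) ∧
        ∀ (x : ZdEdge d), ∀ y ∈ linkPlaqNbr x,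
          ∀ (ω η : LGConfig d (Matrix.specialUnitaryGroup (Fin N) ℂ)),
          (∀ z, z ≠ y → ω z = η z) →
          ∀ (φ : Matrix.specialUnitaryGroup (Fin N) ℂ → ℝ) (L : ℝ), Measurable φ →
            (∃ M, ∀ s, |φ s| ≤ M) → 0 ≤ L → (∀ a b, |φ a - φ b| ≤ L * r a b) →
            |∫ s, φ s ∂(siteLaw (ymSpecification (fundamentalRep (Fin N)) (N * β)) x ω) -
                ∫ s, φ s ∂(siteLaw (ymSpecification (fundamentalRep (Fin N)) (N * β)) x η)| ≤
              C x y * L * r (ω y) (η y)) :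
    shen_zhu_zhu d N := by
  intro hd hN β hβ
  obtain ⟨r, R, A, c, C, hr0, hrR, hA0, hA, hC0, hc1, hrow, hcontr⟩ := hDob hd hN β hβ
  -- `SU(N) ⊆ M_N(ℂ)` is second countable
  haveI : SecondCountableTopology (Matrix (Fin N) (Fin N) ℂ) :=
    inferInstanceAs (SecondCountableTopology (Fin N → Fin N → ℂ))
  haveI : SecondCountableTopology (Matrix.specialUnitaryGroup (Fin N) ℂ) :=
    Topology.IsEmbedding.subtypeVal.secondCountableTopology
  have hγ : IsSpecification (ymSpecification (d := d) (fundamentalRep (Fin N)) (N * β)) :=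
    isSpecification_ymSpecification_of_t2Space _ (continuous_fundamentalRep (Fin N)) _
  have hKR : IsKRContraction (ymSpecification (d := d) (fundamentalRep (Fin N)) (N * β)) r
      linkPlaqNbr C :=
    isKRContraction_ymSpecification _ (continuous_fundamentalRep (Fin N)) _ hC0 hcontr
  have hd0 : 0 < d := by omega
  have e₀ : ZdEdge d := (0, ⟨0, hd0⟩)
  have hc0 : 0 ≤ c := (Finset.sum_nonneg fun y _ => hC0 e₀ y).trans (hrow e₀)
  have hR : 0 ≤ R := (hr0 1 1).trans (hrR 1 1)
  refine ⟨?_, ?_⟩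
  · -- (i) uniqueness (Dobrushin) and existence (compactness)
    refine (shen_zhu_zhu_hasUniqueGibbsMeasure_iff β).2 ?_
    exact subsingleton_gibbsMeasures_of_isKRContraction hγ hKR hr0 hrR suEntries
      measurableSpace_specialUnitaryGroup_eq_comap hA0 hA hc0 hc1 hrow
  · -- (ii) exponential decay of covariances
    intro μ hμ
    set c' : ℝ := max c (1 / 2) with hc'
    have hc'0 : 0 < c' := lt_max_of_lt_right (by norm_num)
    have hc'1 : c' < 1 := max_lt hc1 (by norm_num)
    have hrow' : ∀ x, ∑ y ∈ linkPlaqNbr x, C x y ≤ c' := fun x => (hrow x).trans (le_max_left _ _)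
    set κ : ℝ := -Real.log c' with hκ
    have hκ0 : 0 < κ := neg_pos.2 (Real.log_neg hc'0 hc'1)
    refine ⟨κ, hκ0, fun n => ⟨2 * R ^ 2 * A ^ 2 * (n : ℝ) ^ 2 * Real.exp κ, ?_⟩⟩
    intro F₁ F₂ Λ₁ Λ₂ K₁ K₂ h₁ h₂ _ hF₁ hF₂
    have hμ' : IsGibbsMeasure (ymSpecification (d := d) (fundamentalRep (Fin N)) (N * β)) μ := hμ
    haveI := hμ'.isProbabilityMeasure
    -- the profile `ℓ = ⌊dist(·, Λ₂)⌋`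
    set ℓ : ZdEdge d → ℕ := fun y => ⌊linkSetDist Λ₂ y⌋₊ with hℓ
    have hℓ0 : ∀ y ∈ Λ₂, ℓ y = 0 := fun y hy => by
      simp [hℓ, linkSetDist_eq_zero_of_mem hy]
    have hℓ1 : ∀ x ∉ Λ₂, ∀ y ∈ linkPlaqNbr x, ℓ x ≤ ℓ y + 1 := fun x _ y hy => by
      calc ℓ x ≤ ⌊linkSetDist Λ₂ y + 1⌋₊ := Nat.floor_mono (linkSetDist_le_add_one hy)
        _ = ℓ y + 1 := Nat.floor_add_one (linkSetDist_nonneg _ _)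
    -- the covariance estimate of the Dobrushin regime
    have key := abs_covariance_le_of_isKRContraction hγ hKR hr0 hrR hR hc'0.le hc'1.le hrow' hμ'
      hF₁.measurable hF₁.dependsOn hF₁.abs_le (hF₁.isLipBound hA0 hA)
      hF₂.measurable hF₂.dependsOn hF₂.abs_le (hF₂.isLipBound hA0 hA) ℓ hℓ0 hℓ1
    have hK₁ : (0 : ℝ) ≤ K₁ := K₁.2
    have hK₂ : (0 : ℝ) ≤ K₂ := K₂.2
    have hn₁ : (Λ₁.card : ℝ) ≤ n := by exact_mod_cast h₁
    have hn₂ : (Λ₂.card : ℝ) ≤ n := by exact_mod_cast h₂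
    -- the two sums
    have hsum₂ : ∑ y ∈ Λ₂, (if y ∈ Λ₂ then A * (K₂ : ℝ) else 0) ≤ n * (A * K₂) := by
      rw [Finset.sum_ite_of_true (fun y hy => hy), Finset.sum_const, nsmul_eq_mul]
      exact mul_le_mul_of_nonneg_right hn₂ (by positivity)
    have hm : ∀ y ∈ Λ₁, ⌊setDistEdges Λ₁ Λ₂⌋₊ ≤ ℓ y := fun y hy =>
      Nat.floor_mono (setDistEdges_le_linkSetDist hy)
    have hsum₁ : ∑ y ∈ Λ₁, c' ^ ℓ y * (if y ∈ Λ₁ then A * (K₁ : ℝ) else 0) ≤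
        n * (c' ^ ⌊setDistEdges Λ₁ Λ₂⌋₊ * (A * K₁)) := by
      calc ∑ y ∈ Λ₁, c' ^ ℓ y * (if y ∈ Λ₁ then A * (K₁ : ℝ) else 0)
          ≤ ∑ y ∈ Λ₁, c' ^ ⌊setDistEdges Λ₁ Λ₂⌋₊ * (A * K₁) := Finset.sum_le_sum fun y hy => by
            rw [if_pos hy]
            exact mul_le_mul_of_nonneg_right (pow_le_pow_of_le_one hc'0.le hc'1.le (hm y hy))
              (by positivity)
        _ = Λ₁.card * (c' ^ ⌊setDistEdges Λ₁ Λ₂⌋₊ * (A * K₁)) := by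
            rw [Finset.sum_const, nsmul_eq_mul]
        _ ≤ n * (c' ^ ⌊setDistEdges Λ₁ Λ₂⌋₊ * (A * K₁)) :=
            mul_le_mul_of_nonneg_right hn₁ (by positivity)
    -- the geometric factor `c'^{⌊d⌋} ≤ e^{κ} e^{-κ d}`
    have hgeom : c' ^ ⌊setDistEdges Λ₁ Λ₂⌋₊ ≤
        Real.exp κ * Real.exp (-κ * setDistEdges Λ₁ Λ₂) := by
      have hfl : setDistEdges Λ₁ Λ₂ - 1 ≤ (⌊setDistEdges Λ₁ Λ₂⌋₊ : ℝ) := by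
        have := Nat.lt_floor_add_one (setDistEdges Λ₁ Λ₂)
        linarith
      rw [← Real.exp_add, ← Real.rpow_natCast, Real.rpow_def_of_pos hc'0]
      refine Real.exp_le_exp.2 ?_
      have hlog : Real.log c' = -κ := by rw [hκ, neg_neg]
      rw [hlog]
      have := mul_le_mul_of_nonneg_left hfl hκ0.le
      linarith
    have hsD := setDistEdges_nonneg Λ₁ Λ₂
    calc |cov[F₁, F₂; μ]|
        ≤ 2 * R ^ 2 * (∑ y ∈ Λ₂, (if y ∈ Λ₂ then A * (K₂ : ℝ) else 0)) *
            ∑ y ∈ Λ₁, c' ^ ℓ y * (if y ∈ Λ₁ then A * (K₁ : ℝ) else 0) := key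
      _ ≤ 2 * R ^ 2 * (n * (A * K₂)) * (n * (c' ^ ⌊setDistEdges Λ₁ Λ₂⌋₊ * (A * K₁))) := by
          refine mul_le_mul (mul_le_mul_of_nonneg_left hsum₂ (by positivity)) hsum₁
            (Finset.sum_nonneg fun y hy => ?_) (by positivity)
          rw [if_pos hy]; positivity
      _ ≤ 2 * R ^ 2 * (n * (A * K₂)) *
            (n * (Real.exp κ * Real.exp (-κ * setDistEdges Λ₁ Λ₂) * (A * K₁))) := by
          gcongr
      _ = 2 * R ^ 2 * A ^ 2 * (n : ℝ) ^ 2 * Real.exp κ * Real.exp (-κ * setDistEdges Λ₁ Λ₂) *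
            ((K₁ : ℝ) * K₂) := by ring
      _ ≤ 2 * R ^ 2 * A ^ 2 * (n : ℝ) ^ 2 * Real.exp κ * Real.exp (-κ * setDistEdges Λ₁ Λ₂) *
            ((K₁ : ℝ) * K₂ + Real.sqrt (∫ U, F₁ U ^ 2 ∂μ) * Real.sqrt (∫ U, F₂ U ^ 2 ∂μ)) := by
          gcongr
          exact le_add_of_nonneg_right (by positivity)

/-- **`shen_zhu_zhu` from a uniform one-link contraction rate** (the form in which the
Bakry–Émery computation delivers Dobrushin's condition; Shen–Zhu–Zhu CMP 400 (2023), remark after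
Rem. 1.3, with Föllmer 1988, Ch. I, (2.7)): if for `2 ≤ d`, `2 ≤ N`, `|β| < 1/(16(d-1))` the
one-link conditional laws of the `SU(N)` Wilson specification at bare coupling `N β` contract at a
uniform Kantorovich–Rubinstein rate `κ ≥ 0` (for some bounded weight `r` dominating the entry
metric) under the change of any one plaquette-neighbour link, and `6(d-1) κ < 1`, then
`shen_zhu_zhu d N` holds — a link has at most `6(d-1)` plaquette neighbours
(`card_linkPlaqNbr_le`), so Dobrushin's constant is `≤ 6(d-1) κ`. The expected rate from the
one-link Bakry–Émery constant is `κ = |β|/(1/2 - 2(d-1)|β|)`, for which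
`6(d-1) κ < 1 ⟺ |β| < 1/(16(d-1))`. [cite: arXiv220412737, Rem. 1.3 ff. (Dobrushin route, p. 6) with Thm. 1.2 and Cor. 1.6 (Mass gap)] -/
theorem shen_zhu_zhu_of_uniformLinkContraction
    (hκ : 2 ≤ d → 2 ≤ N → ∀ β : ℝ, |β| < 1 / (16 * ((d : ℝ) - 1)) →
      ∃ (r : Matrix.specialUnitaryGroup (Fin N) ℂ → Matrix.specialUnitaryGroup (Fin N) ℂ → ℝ)
        (R A κ : ℝ),
        (∀ a b, 0 ≤ r a b) ∧ (∀ a b, r a b ≤ R) ∧ 0 ≤ A ∧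
        (∀ a b, dist (suEntries a) (suEntries b) ≤ A * r a b) ∧ 0 ≤ κ ∧
        6 * ((d : ℝ) - 1) * κ < 1 ∧
        ∀ (x : ZdEdge d), ∀ y ∈ linkPlaqNbr x,
          ∀ (ω η : LGConfig d (Matrix.specialUnitaryGroup (Fin N) ℂ)),
          (∀ z, z ≠ y → ω z = η z) →
          ∀ (φ : Matrix.specialUnitaryGroup (Fin N) ℂ → ℝ) (L : ℝ), Measurable φ →
            (∃ M, ∀ s, |φ s| ≤ M) → 0 ≤ L → (∀ a b, |φ a - φ b| ≤ L * r a b) →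
            |∫ s, φ s ∂(siteLaw (ymSpecification (fundamentalRep (Fin N)) (N * β)) x ω) -
                ∫ s, φ s ∂(siteLaw (ymSpecification (fundamentalRep (Fin N)) (N * β)) x η)| ≤
              κ * L * r (ω y) (η y)) :
    shen_zhu_zhu d N := by
  refine shen_zhu_zhu_of_dobrushinCondition fun hd hN β hβ => ?_
  obtain ⟨r, R, A, κ, hr0, hrR, hA0, hA, hκ0, hκ1, hcontr⟩ := hκ hd hN β hβ
  refine ⟨r, R, A, 6 * ((d : ℝ) - 1) * κ, fun _ _ => κ, hr0, hrR, hA0, hA, fun _ _ => hκ0, hκ1,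
    fun x => ?_, hcontr⟩
  rw [Finset.sum_const, nsmul_eq_mul]
  have hcard : ((linkPlaqNbr x).card : ℝ) ≤ 6 * ((d : ℝ) - 1) := by
    have h := card_linkPlaqNbr_le x
    have hd1 : 1 ≤ d := by omega
    calc ((linkPlaqNbr x).card : ℝ) ≤ ((6 * (d - 1) : ℕ) : ℝ) := by exact_mod_cast h
      _ = 6 * ((d : ℝ) - 1) := by push_cast [Nat.cast_sub hd1]; ring
  exact mul_le_mul_of_nonneg_right hcard hκ0

end Reduction

/-! ### Sanity check: infinite temperature -/

section Zero

variable [TopologicalSpace G] [IsTopologicalGroup G] [CompactSpace G] [MeasurableSpace G]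
  [BorelSpace G] [SecondCountableTopology G] (ρ : G →* Matrix (Fin N) (Fin N) ℂ)

/-- At `β = 0` the one-link conditional law is Haar measure whatever the boundary condition.
[folklore] -/
theorem siteLaw_ymSpecification_zero (hρ : Continuous ρ) (e : ZdEdge d) (ω η : LGConfig d G) :
    siteLaw (ymSpecification ρ 0) e ω = siteLaw (ymSpecification ρ 0) e η := by
  rw [siteLaw_ymSpecification_eq ρ hρ 0 e ω, siteLaw_ymSpecification_eq ρ hρ 0 e η]
  congr 2
  funext ζ
  simp

/-- At `β = 0` the Wilson specification satisfies Dobrushin's condition with zero influence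
coefficients, for any weight. [folklore] -/
theorem isKRContraction_ymSpecification_zero (hρ : Continuous ρ) (r : G → G → ℝ) :
    IsKRContraction (ymSpecification (d := d) ρ 0) r linkPlaqNbr (fun _ _ => 0) :=
  isKRContraction_ymSpecification ρ hρ 0 (fun _ _ => le_rfl)
    fun x y _ ω η _ φ L _ _ _ _ => by
      rw [siteLaw_ymSpecification_zero ρ hρ x ω η, sub_self, abs_zero, zero_mul, zero_mul]

end Zero

/-- **Non-vacuity of the reduction: uniqueness of the `SU(N)` lattice gauge DLR state at
`β = 0`** through the Dobrushin machinery (zero influence coefficients, entry metric as weight):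
`|𝒢(ymSpecification (fundamentalRep (Fin N)) 0)| = 1` for all `d`, `N` (infinite temperature:
the DLR state is the product Haar measure). [folklore] -/
theorem hasUniqueGibbsMeasure_ymSpecification_fundamentalRep_zero :
    HasUniqueGibbsMeasure (ymSpecification (d := d) (fundamentalRep (Fin N)) 0) := by
  haveI : SecondCountableTopology (Matrix (Fin N) (Fin N) ℂ) :=
    inferInstanceAs (SecondCountableTopology (Fin N → Fin N → ℂ))
  haveI : SecondCountableTopology (Matrix.specialUnitaryGroup (Fin N) ℂ) :=
    Topology.IsEmbedding.subtypeVal.secondCountableTopology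
  have hγ : IsSpecification (ymSpecification (d := d) (fundamentalRep (Fin N)) 0) :=
    isSpecification_ymSpecification_of_t2Space _ (continuous_fundamentalRep (Fin N)) _
  refine ⟨?_, ymGibbsMeasures_nonempty (d := d) (fundamentalRep (Fin N))
    (continuous_fundamentalRep (Fin N)) 0⟩
  exact subsingleton_gibbsMeasures_of_isKRContraction hγ
    (isKRContraction_ymSpecification_zero (d := d) (fundamentalRep (Fin N))
      (continuous_fundamentalRep (Fin N)) fun a b => dist (suEntries a) (suEntries b))
    (fun _ _ => dist_nonneg) dist_suEntries_le_two suEntries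
    measurableSpace_specialUnitaryGroup_eq_comap zero_le_one (fun a b => by rw [one_mul]) le_rfl
    zero_lt_one (fun x => by simp)

end Literature.MathematicalPhysics.QuantumFieldTheory
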